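import Summits.Ventures.DiscreteObjects.Hadamard.FixedBlockRankTests

/-!
# The partial-Hadamard rank tests at the extremal fixed subgraphs of orders `7`, `5`, `3` (and `11`) of srg(333,166,82,83) (kernel)

Framing: lottery ticket; floor = certified bounds/negative ranges.  Cell pub-namedobj (venture DiscreteObjects),
target (H) = `H(668)`, hadamard gen 32.  INSTANCES of `FixedBlockRankTests.fixedBlock_commuting_rank_tests` at the conference-type fixed
subgraphs of `ConferenceGraph333FixedBlockOrthogonal`: for an automorphism `ρ` of prime order `p` of a hypothetical srg(333,166,82,83) with
`Fix ρ` extremal — `p = 11` (`25` fixed, forced), `p = 7` with `25` fixed, `p = 5` with `13` fixed, `p = 3` with `9` fixed — and any automorphism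
`σ` commuting with `ρ`, `σ^N = 1` (`N > 0`), writing `T_j = #{x : ρx ≠ x, σʲx ∈ ⟨ρ⟩x}` and `f_j = #{x : σʲx = x, ρx = x}`:
* **`aut_order7_fixed25_rank_tests`** — `(T_j − 7 f_j)² ≤ 133²` (`= (7·19)²`: `44` orbits, corank `19`) for all `j`, and `0 ≤ Σ_{j<N} (T_j − 7 f_j)`;
* **`aut_order5_fixed13_rank_tests`** — `(T_j − 5 f_j)² ≤ 255²` (`64` orbits, corank `51`), `0 ≤ Σ_{j<N} (T_j − 5 f_j)`;
* **`aut_order3_fixed9_rank_tests`** — `(T_j − 3 f_j)² ≤ 297²` (`108` orbits, corank `99`), `0 ≤ Σ_{j<N} (T_j − 3 f_j)`;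
* `aut_order11_rank_tests` — `(T_j − 11 f_j)² ≤ 33²`, `0 ≤ Σ_{j<N} (T_j − 11 f_j)` (re-derivation of gens 31/32 through the general lemma).
E2 (pub-namedobj-hadamard-g31/results/rank_test_general_g31.txt, character test on the census kit): among the cycle types with an extremal
`Fix ρ` these tests remove `14²²·2²·1²¹` (order 14), `21¹⁴·7²·3⁴·1¹³` (21), five types of order `28`, fourteen of `42`, `70⁴·14²·5⁴·2²·1`,
one of `84`; `40⁸·2⁴·1⁵`, `80⁴·4²·2²·1` — no ORDER is excluded.  WORDS: structure of a HYPOTHETICAL object; ours (PROVISIONAL).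
No `sorry`, no new definitions.
-/

namespace Summit.Ventures.DiscreteObjects.Hadamard

open Finset

section extremalRankTests
variable {V : Type*} [Fintype V] [DecidableEq V]

/-- moved-vertex count from the fixed-vertex count -/
private theorem card_moved_of_fixed (hV : Fintype.card V = 333) (ρ : Equiv.Perm V) {f : ℕ}
    (hf : (univ.filter fun x => ρ x = x).card = f) (hf' : f ≤ 333) :
    (univ.filter fun x => ρ x ≠ x).card = 333 - f := by
  have h := Finset.card_filter_add_card_filter_not (s := (univ : Finset V)) (fun x => ρ x = x)
  rw [Finset.card_univ, hV, hf] at h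
  have : (univ.filter fun x => ¬ ρ x = x).card = 333 - f := by omega
  exact this

/-- **Order `7`, `25` fixed vertices**: `(T_j − 7 f_j)² ≤ 133²` for all `j` and `0 ≤ Σ_{j<N} (T_j − 7 f_j)`. -/
theorem aut_order7_fixed25_rank_tests (hV : Fintype.card V = 333) (A : Matrix V V ℤ)
    (h01 : ∀ x y, A x y = 0 ∨ A x y = 1) (hsymm : ∀ x y, A y x = A x y) (hdiag : ∀ x, A x x = 0)
    (hk : ∀ x, ∑ y, A x y = 166) (hsrg : ∀ x y, ∑ z, A x z * A z y = 83 * (1 + (if x = y then 1 else 0)) - A x y)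
    (ρ : Equiv.Perm V) (hρ : ρ ^ 7 = 1) (hAρ : ∀ x y, A (ρ x) (ρ y) = A x y)
    (hf : (univ.filter fun x => ρ x = x).card = 25)
    (σ : Equiv.Perm V) (hc : σ * ρ = ρ * σ) (hAσ : ∀ x y, A (σ x) (σ y) = A x y) {N : ℕ} (hN : 0 < N) (hσN : σ ^ N = 1) :
    (∀ j : ℕ,
      (((univ.filter fun x => ρ x ≠ x ∧ (σ ^ j) x ∈ (Finset.range 7).image (fun k => (ρ ^ k) x)).card : ℤ)
          - 7 * ((univ.filter fun x => (σ ^ j) x = x ∧ ρ x = x).card : ℤ)) ^ 2 ≤ 133 ^ 2) ∧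
    0 ≤ ∑ j ∈ Finset.range N,
      (((univ.filter fun x => ρ x ≠ x ∧ (σ ^ j) x ∈ (Finset.range 7).image (fun k => (ρ ^ k) x)).card : ℤ)
        - 7 * ((univ.filter fun x => (σ ^ j) x = x ∧ ρ x = x).card : ℤ)) := by
  obtain ⟨hblk1, hblk2⟩ := aut_order7_fixed25_block hV A h01 hsymm hdiag hk hsrg ρ hρ hAρ hf
  obtain ⟨h1, h2⟩ := fixedBlock_commuting_rank_tests A h01 hsymm (by norm_num : Nat.Prime 7) ρ hρ hAρ (K := 77) (by norm_num)
    (fun y hy => by rw [(hblk1 y hy).1]; norm_num) (fun y hy y' hy' hne => (hblk2 y hy y' hy' hne).1) σ hc hAσ hN hσN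
  refine ⟨fun j => ?_, by exact_mod_cast h2⟩
  have := h1 j
  rw [card_moved_of_fixed hV ρ hf (by norm_num), hf] at this
  exact_mod_cast this

/-- **Order `5`, `13` fixed vertices**: `(T_j − 5 f_j)² ≤ 255²` for all `j` and `0 ≤ Σ_{j<N} (T_j − 5 f_j)`. -/
theorem aut_order5_fixed13_rank_tests (hV : Fintype.card V = 333) (A : Matrix V V ℤ)
    (h01 : ∀ x y, A x y = 0 ∨ A x y = 1) (hsymm : ∀ x y, A y x = A x y) (hdiag : ∀ x, A x x = 0)
    (hk : ∀ x, ∑ y, A x y = 166) (hsrg : ∀ x y, ∑ z, A x z * A z y = 83 * (1 + (if x = y then 1 else 0)) - A x y)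
    (ρ : Equiv.Perm V) (hρ : ρ ^ 5 = 1) (hAρ : ∀ x y, A (ρ x) (ρ y) = A x y)
    (hf : (univ.filter fun x => ρ x = x).card = 13)
    (σ : Equiv.Perm V) (hc : σ * ρ = ρ * σ) (hAσ : ∀ x y, A (σ x) (σ y) = A x y) {N : ℕ} (hN : 0 < N) (hσN : σ ^ N = 1) :
    (∀ j : ℕ,
      (((univ.filter fun x => ρ x ≠ x ∧ (σ ^ j) x ∈ (Finset.range 5).image (fun k => (ρ ^ k) x)).card : ℤ)
          - 5 * ((univ.filter fun x => (σ ^ j) x = x ∧ ρ x = x).card : ℤ)) ^ 2 ≤ 255 ^ 2) ∧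
    0 ≤ ∑ j ∈ Finset.range N,
      (((univ.filter fun x => ρ x ≠ x ∧ (σ ^ j) x ∈ (Finset.range 5).image (fun k => (ρ ^ k) x)).card : ℤ)
        - 5 * ((univ.filter fun x => (σ ^ j) x = x ∧ ρ x = x).card : ℤ)) := by
  obtain ⟨hblk1, hblk2⟩ := aut_order5_fixed13_block hV A h01 hsymm hdiag hk hsrg ρ hρ hAρ hf
  obtain ⟨h1, h2⟩ := fixedBlock_commuting_rank_tests A h01 hsymm (by norm_num : Nat.Prime 5) ρ hρ hAρ (K := 80) (by norm_num)
    (fun y hy => by rw [(hblk1 y hy).1]; norm_num) (fun y hy y' hy' hne => (hblk2 y hy y' hy' hne).1) σ hc hAσ hN hσN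
  refine ⟨fun j => ?_, by exact_mod_cast h2⟩
  have := h1 j
  rw [card_moved_of_fixed hV ρ hf (by norm_num), hf] at this
  exact_mod_cast this

/-- **Order `3`, `9` fixed vertices**: `(T_j − 3 f_j)² ≤ 297²` for all `j` and `0 ≤ Σ_{j<N} (T_j − 3 f_j)`. -/
theorem aut_order3_fixed9_rank_tests (hV : Fintype.card V = 333) (A : Matrix V V ℤ)
    (h01 : ∀ x y, A x y = 0 ∨ A x y = 1) (hsymm : ∀ x y, A y x = A x y) (hdiag : ∀ x, A x x = 0)
    (hk : ∀ x, ∑ y, A x y = 166) (hsrg : ∀ x y, ∑ z, A x z * A z y = 83 * (1 + (if x = y then 1 else 0)) - A x y)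
    (ρ : Equiv.Perm V) (hρ : ρ ^ 3 = 1) (hAρ : ∀ x y, A (ρ x) (ρ y) = A x y)
    (hf : (univ.filter fun x => ρ x = x).card = 9)
    (σ : Equiv.Perm V) (hc : σ * ρ = ρ * σ) (hAσ : ∀ x y, A (σ x) (σ y) = A x y) {N : ℕ} (hN : 0 < N) (hσN : σ ^ N = 1) :
    (∀ j : ℕ,
      (((univ.filter fun x => ρ x ≠ x ∧ (σ ^ j) x ∈ (Finset.range 3).image (fun k => (ρ ^ k) x)).card : ℤ)
          - 3 * ((univ.filter fun x => (σ ^ j) x = x ∧ ρ x = x).card : ℤ)) ^ 2 ≤ 297 ^ 2) ∧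
    0 ≤ ∑ j ∈ Finset.range N,
      (((univ.filter fun x => ρ x ≠ x ∧ (σ ^ j) x ∈ (Finset.range 3).image (fun k => (ρ ^ k) x)).card : ℤ)
        - 3 * ((univ.filter fun x => (σ ^ j) x = x ∧ ρ x = x).card : ℤ)) := by
  obtain ⟨hblk1, hblk2⟩ := aut_order3_fixed9_block hV A h01 hsymm hdiag hk hsrg ρ (e := 1) (by simpa using hρ) hAρ hf
  obtain ⟨h1, h2⟩ := fixedBlock_commuting_rank_tests A h01 hsymm (by norm_num : Nat.Prime 3) ρ hρ hAρ (K := 81) (by norm_num)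
    (fun y hy => by rw [(hblk1 y hy).1]; norm_num) (fun y hy y' hy' hne => (hblk2 y hy y' hy' hne).1) σ hc hAσ hN hσN
  refine ⟨fun j => ?_, by exact_mod_cast h2⟩
  have := h1 j
  rw [card_moved_of_fixed hV ρ hf (by norm_num), hf] at this
  exact_mod_cast this

/-- **Order `11`** (`25` fixed vertices, forced): `(T_j − 11 f_j)² ≤ 33²` for all `j` and `0 ≤ Σ_{j<N} (T_j − 11 f_j)` — the gen-31/32 tests
re-derived through the general lemma. -/
theorem aut_order11_rank_tests (hV : Fintype.card V = 333) (A : Matrix V V ℤ)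
    (h01 : ∀ x y, A x y = 0 ∨ A x y = 1) (hsymm : ∀ x y, A y x = A x y) (hdiag : ∀ x, A x x = 0)
    (hk : ∀ x, ∑ y, A x y = 166) (hsrg : ∀ x y, ∑ z, A x z * A z y = 83 * (1 + (if x = y then 1 else 0)) - A x y)
    (ρ : Equiv.Perm V) (hρ : ρ ^ 11 = 1) (hρ1 : ρ ≠ 1) (hAρ : ∀ x y, A (ρ x) (ρ y) = A x y)
    (σ : Equiv.Perm V) (hc : σ * ρ = ρ * σ) (hAσ : ∀ x y, A (σ x) (σ y) = A x y) {N : ℕ} (hN : 0 < N) (hσN : σ ^ N = 1) :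
    (∀ j : ℕ,
      (((univ.filter fun x => ρ x ≠ x ∧ (σ ^ j) x ∈ (Finset.range 11).image (fun k => (ρ ^ k) x)).card : ℤ)
          - 11 * ((univ.filter fun x => (σ ^ j) x = x ∧ ρ x = x).card : ℤ)) ^ 2 ≤ 33 ^ 2) ∧
    0 ≤ ∑ j ∈ Finset.range N,
      (((univ.filter fun x => ρ x ≠ x ∧ (σ ^ j) x ∈ (Finset.range 11).image (fun k => (ρ ^ k) x)).card : ℤ)
        - 11 * ((univ.filter fun x => (σ ^ j) x = x ∧ ρ x = x).card : ℤ)) := by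
  obtain ⟨hf, -, hblk1, hblk2, -⟩ := aut_order11_fixed_block hV A h01 hsymm hdiag hk hsrg ρ hρ hρ1 hAρ
  obtain ⟨h1, h2⟩ := fixedBlock_commuting_rank_tests A h01 hsymm (by norm_num : Nat.Prime 11) ρ hρ hAρ (K := 77) (by norm_num)
    (fun y hy => by rw [(hblk1 y hy).1]; norm_num) (fun y hy y' hy' hne => (hblk2 y hy y' hy' hne).1) σ hc hAσ hN hσN
  refine ⟨fun j => ?_, by exact_mod_cast h2⟩
  have := h1 j
  rw [card_moved_of_fixed hV ρ hf (by norm_num), hf] at this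
  exact_mod_cast this

end extremalRankTests

end Summit.Ventures.DiscreteObjects.Hadamard
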